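import Literature.NumberTheory.Automorphic.Liu2021.AppendixC.TowerMorphismRefl
import Literature.NumberTheory.Automorphic.Liu2021.AppendixC.TowerMorphismLift
import Literature.NumberTheory.Automorphic.Liu2021.AppendixC.TowerMorphismComp
import HarnessLib

/-!
# The lift `TowerHom ↦ EtaleTowerHom` is FUNCTORIAL: the constructed pull-back of a composite is the composite of the
# pull-backs, that of the identity is the identity (typer row T2-R2′ of the cell's LIU415-SPEC §7; K-a/K-b/K-c glued)

Topic `NumberTheory/Automorphic/Liu2021/AppendixC`; namespace `Literature.NumberTheory.Automorphic.Liu2021.AppendixC`.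
THEOREMS ONLY; NO definition, NO named fact, NO instance, NO notation, NO `sorry`; net Literature debt 0; nothing of
[Liu2021] is asserted.

The étale receptacle ★ `Sec42Data.EtaleTowerHom` posits its pull-back `etPull` by ONE law, the defining square with the level
pull-backs `ᵗV_ℓ(Alb(map K))`, and ★ `etPull_unique` says the square pins it.  Three files realise the square: ★
`AppendixC/TowerMorphismLift` (K-b: `TowerHom.toEtaleTowerHom`, `etPull := Module.DirectLimit.lift …`), ★
`AppendixC/TowerMorphismRefl` (K-a: `EtaleTowerHom.refl`, `etPull := id`), ★ `AppendixC/TowerMorphismComp` (K-c: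
`EtaleTowerHom.comp`, `etPull := etPull₁₂ ∘ etPull₂₃`).  By uniqueness the three agree wherever their geometric data do —
which is the content of this file ([Milne2005ShimuraVarieties] §5 p. 58 L6–11: the maps `T(g)` compose; Rem. 13.8 p. 119):

* `Sec42Data.TowerHom.toEtaleTowerHom_comp_etPull` — `(M₂₃.comp M₁₂).toEtaleTowerHom.etPull = M₁₂.toEtaleTowerHom.etPull ∘
  M₂₃.toEtaleTowerHom.etPull` (contravariant), with `etPullLift_comp` / `etPullLift_comp_apply`;
* `Sec42Data.TowerHom.toEtaleTowerHom_refl_etPull` — `(TowerHom.refl C T).toEtaleTowerHom.etPull = id`, with `etPullLift_refl`;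
* `Sec42Data.EtaleTowerHom.comp_toEtaleTowerHom_etPull` — `EtaleTowerHom.comp` of two lifts has the lifted composite's pull-back.

## References
* [Milne2005ShimuraVarieties] J. S. Milne, *Introduction to Shimura varieties* (2005), §5 p. 58 L6–11, Thm. 13.6 p. 118, Rem. 13.8
  p. 119.
* [Liu2021] Y. Liu, *Fourier–Jacobi cycles and arithmetic relative trace formula*, §4.3 l. 2152–2160.
* Tree: `AppendixC.TowerMorphism` (★ p640334 `etPull_unique`), `TowerMorphismLift` (★ p642283), `TowerMorphismRefl`
  (★ p642343), `TowerMorphismComp` (★ p642878).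
-/

set_option autoImplicit false

noncomputable section

open CategoryTheory NumberField
open scoped TensorProduct

namespace Literature.NumberTheory.Automorphic.Liu2021.AppendixC

section Sec42

variable {F E : Type} [Field F] [NumberField F] [IsTotallyReal F] [Field E] [NumberField E] [Algebra F E]
  [IsTotallyComplex E] [Algebra.IsQuadraticExtension F E]
variable {P5₁ P5₂ P5₃ : PropC5Data F E} {iso₁ iso₂ iso₃ : ℕ → Prop}
variable {C₁ : Sec42Data P5₁ iso₁} {C₂ : Sec42Data P5₂ iso₂} {C₃ : Sec42Data P5₃ iso₃}
variable {T₁ : C₁.HeckeTranslates} {T₂ : C₂.HeckeTranslates} {T₃ : C₃.HeckeTranslates}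
variable {φ : C₁.G →* C₂.G} {hφ : Continuous φ} {ψ : C₂.G →* C₃.G} {hψ : Continuous ψ}

namespace Sec42Data.TowerHom

/-- **The lifted pull-back of a composite is the composite of the lifted pull-backs** (contravariantly):
`(M₂₃.comp M₁₂).toEtaleTowerHom.etPull ℓ = M₁₂.toEtaleTowerHom.etPull ℓ ∘ₗ M₂₃.toEtaleTowerHom.etPull ℓ` — ★ `etPull_unique`
(through ★ `EtaleTowerHom.etPull_eq_comp_of_map_eq`) applied to the lift of the composite, whose geometric datum IS the composite
(`toEtaleTowerHom_map`, `rfl`). [cite: Milne2005ShimuraVarieties, §5 p. 58 L6–11 and Rem. 13.8 p. 119] -/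
theorem toEtaleTowerHom_comp_etPull (hK₀ : (C₁.S.K₀.1 : Subgroup C₁.G).map φ ≤ C₂.S.K₀.1)
    (M₂₃ : Sec42Data.TowerHom C₂ C₃ T₂ T₃ ψ hψ) (M₁₂ : Sec42Data.TowerHom C₁ C₂ T₁ T₂ φ hφ) (ℓ : ℕ) [Fact ℓ.Prime] :
    (comp hK₀ M₂₃ M₁₂).toEtaleTowerHom.etPull ℓ = M₁₂.toEtaleTowerHom.etPull ℓ ∘ₗ M₂₃.toEtaleTowerHom.etPull ℓ :=
  Sec42Data.EtaleTowerHom.etPull_eq_comp_of_map_eq hK₀ M₂₃.toEtaleTowerHom M₁₂.toEtaleTowerHom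
    (comp hK₀ M₂₃ M₁₂).toEtaleTowerHom rfl ℓ

/-- The same for the `DirectLimit.lift` itself: `(M₂₃.comp M₁₂).etPullLift ℓ = M₁₂.etPullLift ℓ ∘ₗ M₂₃.etPullLift ℓ`.
[cite: Milne2005ShimuraVarieties, §5 p. 58 L6–11] -/
theorem etPullLift_comp (hK₀ : (C₁.S.K₀.1 : Subgroup C₁.G).map φ ≤ C₂.S.K₀.1)
    (M₂₃ : Sec42Data.TowerHom C₂ C₃ T₂ T₃ ψ hψ) (M₁₂ : Sec42Data.TowerHom C₁ C₂ T₁ T₂ φ hφ) (ℓ : ℕ) [Fact ℓ.Prime] :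
    (comp hK₀ M₂₃ M₁₂).etPullLift ℓ = M₁₂.etPullLift ℓ ∘ₗ M₂₃.etPullLift ℓ :=
  toEtaleTowerHom_comp_etPull hK₀ M₂₃ M₁₂ ℓ

/-- Pointwise: `(M₂₃.comp M₁₂).etPullLift ℓ x = M₁₂.etPullLift ℓ (M₂₃.etPullLift ℓ x)`. [cite: Milne2005ShimuraVarieties, §5 p. 58 L6–11] -/
theorem etPullLift_comp_apply (hK₀ : (C₁.S.K₀.1 : Subgroup C₁.G).map φ ≤ C₂.S.K₀.1)
    (M₂₃ : Sec42Data.TowerHom C₂ C₃ T₂ T₃ ψ hψ) (M₁₂ : Sec42Data.TowerHom C₁ C₂ T₁ T₂ φ hφ) (ℓ : ℕ) [Fact ℓ.Prime]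
    (x : C₃.etaleH1Tower ℓ) :
    (comp hK₀ M₂₃ M₁₂).etPullLift ℓ x = M₁₂.etPullLift ℓ (M₂₃.etPullLift ℓ x) :=
  LinearMap.congr_fun (etPullLift_comp hK₀ M₂₃ M₁₂ ℓ) x

/-- **The lifted pull-back of the identity morphism is the identity**: `(TowerHom.refl C T).toEtaleTowerHom.etPull ℓ = id` —
★ `etPull_unique` against ★ `EtaleTowerHom.refl C T` (`etPull := id`, same geometric datum by `rfl`).
[cite: Milne2005ShimuraVarieties, Thm. 13.7 (a) p. 119] -/
theorem toEtaleTowerHom_refl_etPull (C : Sec42Data P5₁ iso₁) (T : C.HeckeTranslates) (ℓ : ℕ) [Fact ℓ.Prime] :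
    (refl C T).toEtaleTowerHom.etPull ℓ = LinearMap.id := by
  rw [← Sec42Data.EtaleTowerHom.refl_etPull (C := C) T ℓ]
  exact (Sec42Data.EtaleTowerHom.refl C T).etPull_unique ℓ (refl C T).toEtaleTowerHom rfl

/-- The same for the `DirectLimit.lift`: `(TowerHom.refl C T).etPullLift ℓ = id`. [cite: Milne2005ShimuraVarieties, Thm. 13.7 (a) p. 119] -/
theorem etPullLift_refl (C : Sec42Data P5₁ iso₁) (T : C.HeckeTranslates) (ℓ : ℕ) [Fact ℓ.Prime] :
    (refl C T).etPullLift ℓ = LinearMap.id :=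
  toEtaleTowerHom_refl_etPull C T ℓ

end Sec42Data.TowerHom

namespace Sec42Data.EtaleTowerHom

/-- `EtaleTowerHom.comp` of two LIFTS pulls back like the lift of the composite geometric datum (both sides equal
`etPullLift₁₂ ∘ etPullLift₂₃`). [cite: Milne2005ShimuraVarieties, §5 p. 58 L6–11 and Rem. 13.8 p. 119] -/
theorem comp_toEtaleTowerHom_etPull (hK₀ : (C₁.S.K₀.1 : Subgroup C₁.G).map φ ≤ C₂.S.K₀.1)
    (M₂₃ : Sec42Data.TowerHom C₂ C₃ T₂ T₃ ψ hψ) (M₁₂ : Sec42Data.TowerHom C₁ C₂ T₁ T₂ φ hφ) (ℓ : ℕ) [Fact ℓ.Prime] :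
    (comp hK₀ M₂₃.toEtaleTowerHom M₁₂.toEtaleTowerHom).etPull ℓ =
      (Sec42Data.TowerHom.comp hK₀ M₂₃ M₁₂).toEtaleTowerHom.etPull ℓ := by
  rw [comp_etPull, Sec42Data.TowerHom.toEtaleTowerHom_comp_etPull]

end Sec42Data.EtaleTowerHom

end Sec42

end Literature.NumberTheory.Automorphic.Liu2021.AppendixC

end
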